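import Summits.QuantumFields.YangMills.Theorems.SwapVirialDeficitZeroModeSigmaFourSmallBallDominator
import Summits.QuantumFields.YangMills.Theorems.SwapVirialDeficitZeroModeGroupThreeHub
import HarnessLib

/-!
# Exact zero-mode rung Z5 — the σ-TWISTED FOUR-LEADER small ball, IV-b: the dominator is integrable over the three letters (per hub)
# (LEAD ym-line-sfw-p2 g93 07:46Z «`Haar⁴{E_σ(t)} = v₇t⁷(1 + O(t^θ))`»; free-hands support of ⟨stmt-QuantumFields-24197⟩)

Part IV-a built the `t`-free majorant `sigmaDom A ((x,y),z) = 𝟙_boxes · exp(4 − qLoad A x y)` of the rescaled σ-events.  Here its Lebesgue integral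
over the three letters is bounded, for an axial hub unit `A = (α, β, 0, 0)` with `αβ ≠ 0`, in w2 g55's pair frame (✓`ZeroModeGroup.pairCoord`):
* §16 the transverse pair Gaussian `gS α β q w` of the load form restricted to one transversal coordinate pair `w = (x_c, y_c)` (`q = (x_I, y_I)`):
  quadratic form `[β²(α² + (16/9)x_I²) + 4y_I²]x_c² − 8x_Iy_I·x_cy_c + 4(β² + x_I²)y_c²` with discriminant
  `4β²·Den`, `Den = (β² + x_I²)(α² + (16/9)x_I²) + 4y_I²` — ★ `lintegral_gS_mul_self : (∫gS)² = π²/(4β²·Den)` (✓`lintegral_exp_neg_quadForm_two`);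
* §17 NO LOGARITHM: `Den ≥ α²β² + x_I² + y_I²` (uses `α² + β² = 1`), so by AM–GM (✓`rpow_neg_sum_three_le`)
  `π²/(4β²Den) ≤ (π²/12)(β²)⁻¹(α²β²)^{−1/3}·(x_I²)^{−1/3}(y_I²)^{−1/3}` — separable singular weights (✓`singPow`, `⊤` at `0`);
* §18 the pair-frame majorant `FdomS` and ★ `lintegral_FdomS_le : ∫ FdomS ≤ 4·K(α,β)·I(1/3)²` (✓`Ising`), `K(α,β) = (π²/12)(β²)⁻¹(α²β²)^{−1/3}`;
* §19 ★★ `lintegral_sigmaDom_le`: `∫_{vol³} sigmaDom A ≤ e⁴·16·(4·K(α,β)·I(1/3)²)` (`z`-box volume `16`, ✓`coord4`).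
Part IV-c integrates `K(α(a), β(a))` over the hub against the cone measure (✓`hub_bound`, `I(4/9)³·I(1/3)`): finite — the `t⁷` law has no log.
HONEST LABEL: finite-dimensional measure theory on `SU(2)⁴` (plan-level zero-mode rung of the DRAFT line «sharp-sigma»); NOT the fixed-`L` sharp law,
NOT ⟨24197⟩; own crux ⟨22884⟩ OPEN (blocked-on ⟨19935⟩); the Yang–Mills mass gap is NOT proved; no summit is proved by a line.
Width seat ym-line-sfw-p2-w3 g63 (cell ym-idea-1, free hands), `--supports stmt-QuantumFields-24197`.  Standard axioms, 0 `sorry`.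
References: [cite: GonzalezarroyoAltes1988]; [cite: Vanbaal2001]; [cite: Luscher1983, §2]; [folklore].
-/

set_option autoImplicit false

noncomputable section

open MeasureTheory Quaternion Set
open scoped Quaternion ENNReal BigOperators
open Literature.MathematicalPhysics.QuantumLattice
open Literature.Analysis.Calculus (radialUnit radialUnit_def norm_radialUnit)
open Summit.QuantumFields.YangMills.Theorems.SwapTwistDeficit.ToronLog
open Summit.QuantumFields.YangMills.Theorems.SwapVirialDeficit.ZeroModeGroup

attribute [local instance] Literature.Analysis.FluidPDE.Tao2016.quatMeasurableSpace
  Literature.Analysis.FluidPDE.Tao2016.quatBorelSpace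
  Literature.MathematicalPhysics.QuantumLattice.secondCountableTopology_su2

namespace Summit.QuantumFields.YangMills.Theorems.SwapVirialDeficit.ZeroModeSigma

/-! ## §16 The transverse pair Gaussian of the load form -/

/-- **The transverse pair Gaussian** of the load form in the pair frame: `q = (x_I, y_I)`, `w = (x_c, y_c)` (`c = J` or `K`),
`gS α β q w = exp(−([β²(α² + (16/9)x_I²) + 4y_I²]x_c² − 8x_Iy_I x_cy_c + 4(β² + x_I²)y_c²))`. [folklore] -/
def gS (α β : ℝ) (q w : ℝ × ℝ) : ℝ≥0∞ :=
  ENNReal.ofReal (Real.exp (-((β ^ 2 * (α ^ 2 + 16 / 9 * q.1 ^ 2) + 4 * q.2 ^ 2) * w.1 ^ 2 + 2 * (-(4 * q.1 * q.2)) * w.1 * w.2 +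
    4 * (β ^ 2 + q.1 ^ 2) * w.2 ^ 2)))

/-- Unfolding `gS` (made irreducible below). [folklore] -/
theorem gS_def (α β : ℝ) (q w : ℝ × ℝ) : gS α β q w =
    ENNReal.ofReal (Real.exp (-((β ^ 2 * (α ^ 2 + 16 / 9 * q.1 ^ 2) + 4 * q.2 ^ 2) * w.1 ^ 2 + 2 * (-(4 * q.1 * q.2)) * w.1 * w.2 +
      4 * (β ^ 2 + q.1 ^ 2) * w.2 ^ 2))) := rfl

/-- `gS` is jointly measurable in `(q, w)`. [folklore] -/
theorem measurable_gS (α β : ℝ) : Measurable fun v : (ℝ × ℝ) × (ℝ × ℝ) => gS α β v.1 v.2 := by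
  unfold gS; exact ENNReal.measurable_ofReal.comp (Real.measurable_exp.comp (by fun_prop))

/-- `gS α β q ·` is measurable. [folklore] -/
theorem measurable_gS_right (α β : ℝ) (q : ℝ × ℝ) : Measurable (gS α β q) := by
  have : Measurable fun w : ℝ × ℝ => gS α β q w := by
    unfold gS; exact ENNReal.measurable_ofReal.comp (Real.measurable_exp.comp (by fun_prop))
  exact this

/-- **The denominator** `Den = (β² + x_I²)(α² + (16/9)x_I²) + 4y_I²` of the σ-dominator. [folklore] -/
def den (α β : ℝ) (q : ℝ × ℝ) : ℝ := (β ^ 2 + q.1 ^ 2) * (α ^ 2 + 16 / 9 * q.1 ^ 2) + 4 * q.2 ^ 2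

/-- Unfolding `den`. [folklore] -/
theorem den_def (α β : ℝ) (q : ℝ × ℝ) : den α β q = (β ^ 2 + q.1 ^ 2) * (α ^ 2 + 16 / 9 * q.1 ^ 2) + 4 * q.2 ^ 2 := rfl

/-- The discriminant of the pair form is `4β²·Den`. [folklore] -/
theorem discr_gS (α β : ℝ) (q : ℝ × ℝ) :
    (β ^ 2 * (α ^ 2 + 16 / 9 * q.1 ^ 2) + 4 * q.2 ^ 2) * (4 * (β ^ 2 + q.1 ^ 2)) - (-(4 * q.1 * q.2)) ^ 2 = 4 * β ^ 2 * den α β q := by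
  rw [den]; ring

/-- `Den > 0` whenever `y_I ≠ 0`. [folklore] -/
theorem den_pos {α β : ℝ} {q : ℝ × ℝ} (h2 : q.2 ≠ 0) : 0 < den α β q := by
  rw [den]
  have h : 0 < q.2 ^ 2 := by positivity
  nlinarith [sq_nonneg β, sq_nonneg q.1, sq_nonneg α, mul_nonneg (add_nonneg (sq_nonneg β) (sq_nonneg q.1))
    (add_nonneg (sq_nonneg α) (mul_nonneg (by norm_num : (0:ℝ) ≤ 16 / 9) (sq_nonneg q.1)))]

/-- ★ The exact pair Gaussian: `∫ gS α β q = π/√(4β²·Den)` (`β ≠ 0`, `y_I ≠ 0`). [folklore] -/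
theorem lintegral_gS {α β : ℝ} (hβ : β ≠ 0) {q : ℝ × ℝ} (h2 : q.2 ≠ 0) :
    ∫⁻ w, gS α β q w = ENNReal.ofReal (Real.pi / Real.sqrt (4 * β ^ 2 * den α β q)) := by
  have hpos : 0 < 4 * β ^ 2 * den α β q := by have := den_pos (α := α) (β := β) h2; positivity
  have hδ : 0 < 4 * (β ^ 2 + q.1 ^ 2) := by positivity
  unfold gS
  rw [lintegral_exp_neg_quadForm_two hδ (by rw [discr_gS]; exact hpos), discr_gS]

/-- The two transverse pairs together: `(∫ gS)² = π²/(4β²·Den)`. [folklore] -/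
theorem lintegral_gS_mul_self {α β : ℝ} (hβ : β ≠ 0) {q : ℝ × ℝ} (h2 : q.2 ≠ 0) :
    (∫⁻ w, gS α β q w) * (∫⁻ w, gS α β q w) = ENNReal.ofReal (Real.pi ^ 2 / (4 * β ^ 2 * den α β q)) := by
  have hpos : 0 < 4 * β ^ 2 * den α β q := by have := den_pos (α := α) (β := β) h2; positivity
  rw [lintegral_gS hβ h2, ← ENNReal.ofReal_mul (by positivity)]
  congr 1
  rw [div_mul_div_comm, Real.mul_self_sqrt hpos.le]; ring

attribute [irreducible] gS

/-! ## §17 No logarithm: AM–GM into separable singular weights -/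

/-- **The key lower bound** `Den ≥ α²β² + x_I² + y_I²` for `α² + β² = 1` (from `(β²+x_I²)(α²+(16/9)x_I²) ≥ α²β² + x_I²(α² + β²)`). [folklore] -/
theorem den_ge {α β : ℝ} (h1 : α ^ 2 + β ^ 2 = 1) (q : ℝ × ℝ) : α ^ 2 * β ^ 2 + q.1 ^ 2 + q.2 ^ 2 ≤ den α β q := by
  rw [den]
  nlinarith [sq_nonneg q.1, sq_nonneg q.2, sq_nonneg β, sq_nonneg α, mul_nonneg (sq_nonneg q.1) (sq_nonneg q.1),
    mul_nonneg (sq_nonneg β) (sq_nonneg q.1)]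

/-- **The hub constant** `K(α, β) = (π²/12)·(β²)⁻¹·(α²β²)^{−1/3}`. [folklore] -/
def hubK (α β : ℝ) : ℝ := Real.pi ^ 2 / 12 * (β ^ 2)⁻¹ * (α ^ 2 * β ^ 2) ^ (-(1/3 : ℝ))

/-- Unfolding `hubK`. [folklore] -/
theorem hubK_def (α β : ℝ) : hubK α β = Real.pi ^ 2 / 12 * (β ^ 2)⁻¹ * (α ^ 2 * β ^ 2) ^ (-(1/3 : ℝ)) := rfl

/-- `K(α, β) > 0` for `αβ ≠ 0`. [folklore] -/
theorem hubK_pos {α β : ℝ} (hα : α ≠ 0) (hβ : β ≠ 0) : 0 < hubK α β := by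
  rw [hubK]
  have h1 : 0 < (β ^ 2)⁻¹ := by positivity
  have h2 : 0 < (α ^ 2 * β ^ 2) ^ (-(1/3 : ℝ)) := Real.rpow_pos_of_pos (by positivity) _
  positivity

/-- ★ **AM–GM**: `π²/(4β²·Den) ≤ K(α,β)·(x_I²)^{−1/3}(y_I²)^{−1/3}` for `α² + β² = 1`, `αβ ≠ 0`, `x_I y_I ≠ 0`. [folklore] -/
theorem gaussSqS_bound {α β : ℝ} (h1 : α ^ 2 + β ^ 2 = 1) (hα : α ≠ 0) (hβ : β ≠ 0) {q₁ q₂ : ℝ} (hq1 : q₁ ≠ 0) (hq2 : q₂ ≠ 0) :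
    Real.pi ^ 2 / (4 * β ^ 2 * den α β (q₁, q₂)) ≤ hubK α β * ((q₁ ^ 2) ^ (-(1/3 : ℝ)) * (q₂ ^ 2) ^ (-(1/3 : ℝ))) := by
  have hab : 0 < α ^ 2 * β ^ 2 := by positivity
  have hq1' : 0 < q₁ ^ 2 := by positivity
  have hq2' : 0 < q₂ ^ 2 := by positivity
  have hS : 0 < α ^ 2 * β ^ 2 + q₁ ^ 2 + q₂ ^ 2 := by positivity
  have hD : α ^ 2 * β ^ 2 + q₁ ^ 2 + q₂ ^ 2 ≤ den α β (q₁, q₂) := den_ge h1 (q₁, q₂)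
  have hDpos : 0 < den α β (q₁, q₂) := lt_of_lt_of_le hS hD
  have hβ2 : 0 < β ^ 2 := by positivity
  -- `1/Den ≤ 1/(α²β² + x_I² + y_I²) ≤ 3⁻¹ (α²β²)^{-1/3} (x_I²)^{-1/3} (y_I²)^{-1/3}`
  have hA := rpow_neg_sum_three_le hab hq1' hq2' zero_le_one
  have hA' : (den α β (q₁, q₂)) ^ (-(1:ℝ)) ≤ (α ^ 2 * β ^ 2 + q₁ ^ 2 + q₂ ^ 2) ^ (-(1:ℝ)) :=
    Real.rpow_le_rpow_of_nonpos hS hD (by norm_num)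
  have e1 : Real.pi ^ 2 / (4 * β ^ 2 * den α β (q₁, q₂)) = Real.pi ^ 2 / 4 * (β ^ 2)⁻¹ * (den α β (q₁, q₂)) ^ (-(1:ℝ)) := by
    rw [Real.rpow_neg_one]; field_simp
  rw [e1, hubK]
  have h16 : 0 ≤ Real.pi ^ 2 / 4 * (β ^ 2)⁻¹ := by positivity
  calc Real.pi ^ 2 / 4 * (β ^ 2)⁻¹ * (den α β (q₁, q₂)) ^ (-(1:ℝ))
      ≤ Real.pi ^ 2 / 4 * (β ^ 2)⁻¹ * ((3:ℝ) ^ (-(1:ℝ)) * ((α ^ 2 * β ^ 2) ^ (-(1/3 : ℝ)) * (q₁ ^ 2) ^ (-(1/3 : ℝ)) * (q₂ ^ 2) ^ (-(1/3 : ℝ)))) :=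
        mul_le_mul_of_nonneg_left (hA'.trans (by simpa using hA)) h16
    _ = _ := by rw [Real.rpow_neg_one]; ring

/-- ENNReal form of `gaussSqS_bound` with the `⊤`-valued singular weights (valid for ALL `x_I, y_I`; `α² + β² = 1`, `αβ ≠ 0`). [folklore] -/
theorem gaussSqS_le_sing {α β : ℝ} (h1 : α ^ 2 + β ^ 2 = 1) (hα : α ≠ 0) (hβ : β ≠ 0) (q₁ q₂ : ℝ) (hq2 : q₂ ≠ 0) :
    ENNReal.ofReal (Real.pi ^ 2 / (4 * β ^ 2 * den α β (q₁, q₂))) ≤ ENNReal.ofReal (hubK α β) * (singPow (1/3) q₁ * singPow (1/3) q₂) := by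
  have hK := hubK_pos hα hβ
  have hKne : ENNReal.ofReal (hubK α β) ≠ 0 := (ENNReal.ofReal_pos.2 hK).ne'
  by_cases hq1 : q₁ = 0
  · rw [hq1, singPow_zero, ENNReal.top_mul (singPow_ne_zero _ _), ENNReal.mul_top hKne]; exact le_top
  rw [singPow_of_ne hq1, singPow_of_ne hq2, ← ENNReal.ofReal_mul (Real.rpow_nonneg (sq_nonneg _) _), ← ENNReal.ofReal_mul hK.le]
  exact ENNReal.ofReal_le_ofReal (gaussSqS_bound h1 hα hβ hq1 hq2)

/-! ## §18 The pair-frame majorant and its integral -/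

/-- The separable pair-frame majorant `𝟙_box(x₀,y₀)·𝟙_box(x_I,y_I)·gS(q,w_J)·gS(q,w_K)`. [folklore] -/
def FdomS (α β : ℝ) (w : (ℝ × ℝ) × ((ℝ × ℝ) × ((ℝ × ℝ) × (ℝ × ℝ)))) : ℝ≥0∞ :=
  sqBox.indicator (fun _ => (1 : ℝ≥0∞)) w.1 * (sqBox.indicator (fun _ => (1 : ℝ≥0∞)) w.2.1 * (gS α β w.2.1 w.2.2.1 * gS α β w.2.1 w.2.2.2))

/-- The inner factor of `FdomS` is measurable. [folklore] -/
theorem measurable_FdomS_inner (α β : ℝ) :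
    Measurable fun u : (ℝ × ℝ) × ((ℝ × ℝ) × (ℝ × ℝ)) => sqBox.indicator (fun _ => (1 : ℝ≥0∞)) u.1 * (gS α β u.1 u.2.1 * gS α β u.1 u.2.2) := by
  have hi : Measurable fun p : ℝ × ℝ => sqBox.indicator (fun _ => (1 : ℝ≥0∞)) p := measurable_const.indicator measurableSet_sqBox
  have h1 : Measurable fun u : (ℝ × ℝ) × ((ℝ × ℝ) × (ℝ × ℝ)) => gS α β u.1 u.2.1 :=
    (measurable_gS α β).comp (measurable_fst.prodMk (measurable_fst.comp measurable_snd))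
  have h2 : Measurable fun u : (ℝ × ℝ) × ((ℝ × ℝ) × (ℝ × ℝ)) => gS α β u.1 u.2.2 :=
    (measurable_gS α β).comp (measurable_fst.prodMk (measurable_snd.comp measurable_snd))
  exact (hi.comp measurable_fst).mul (h1.mul h2)

/-- `FdomS` is measurable. [folklore] -/
theorem measurable_FdomS (α β : ℝ) : Measurable (FdomS α β) := by
  have hi : Measurable fun p : ℝ × ℝ => sqBox.indicator (fun _ => (1 : ℝ≥0∞)) p := measurable_const.indicator measurableSet_sqBox
  exact (hi.comp measurable_fst).mul ((measurable_FdomS_inner α β).comp measurable_snd)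

/-- ★ `∫ FdomS ≤ 4·K(α,β)·I(1/3)²` for an axial unit hub with `αβ ≠ 0`: Tonelli in the pair frame, the exact pair Gaussians (for `y_I ≠ 0`, a co-null
set), AM–GM. [folklore] -/
theorem lintegral_FdomS_le {α β : ℝ} (h1 : α ^ 2 + β ^ 2 = 1) (hα : α ≠ 0) (hβ : β ≠ 0) :
    ∫⁻ w, FdomS α β w ≤ 4 * (ENNReal.ofReal (hubK α β) * (Ising (1/3) * Ising (1/3))) := by
  -- the inner Gaussian pair integral, for `y_I ≠ 0`
  have hpair : ∀ q : ℝ × ℝ, q.2 ≠ 0 → ∫⁻ v : (ℝ × ℝ) × (ℝ × ℝ), gS α β q v.1 * gS α β q v.2 =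
      ENNReal.ofReal (Real.pi ^ 2 / (4 * β ^ 2 * den α β q)) := by
    intro q hq
    rw [lintegral_volume_prod_mul (measurable_gS_right α β q) (measurable_gS_right α β q), lintegral_gS_mul_self hβ hq]
  have hmid : ∫⁻ u : (ℝ × ℝ) × ((ℝ × ℝ) × (ℝ × ℝ)), sqBox.indicator (fun _ => (1 : ℝ≥0∞)) u.1 * (gS α β u.1 u.2.1 * gS α β u.1 u.2.2) ≤
      ENNReal.ofReal (hubK α β) * (Ising (1/3) * Ising (1/3)) := by
    rw [lintegral_volume_prod _ (measurable_FdomS_inner α β)]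
    have hin : ∀ q : ℝ × ℝ, ∫⁻ v : (ℝ × ℝ) × (ℝ × ℝ), sqBox.indicator (fun _ => (1 : ℝ≥0∞)) q * (gS α β q v.1 * gS α β q v.2) =
        sqBox.indicator (fun _ => (1 : ℝ≥0∞)) q * ∫⁻ v : (ℝ × ℝ) × (ℝ × ℝ), gS α β q v.1 * gS α β q v.2 := by
      intro q
      have hm : Measurable fun v : (ℝ × ℝ) × (ℝ × ℝ) => gS α β q v.1 * gS α β q v.2 :=
        ((measurable_gS_right α β q).comp measurable_fst).mul ((measurable_gS_right α β q).comp measurable_snd)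
      rw [lintegral_const_mul _ hm]
    simp_rw [hin]
    -- replace the integrand on the co-null set `{y_I ≠ 0}`
    have hae : (fun q : ℝ × ℝ => sqBox.indicator (fun _ => (1 : ℝ≥0∞)) q * ∫⁻ v : (ℝ × ℝ) × (ℝ × ℝ), gS α β q v.1 * gS α β q v.2) ≤ᵐ[volume]
        fun q : ℝ × ℝ => ENNReal.ofReal (hubK α β) *
          ({u : ℝ | u ^ 2 < 1}.indicator (singPow (1/3)) q.1 * {u : ℝ | u ^ 2 < 1}.indicator (singPow (1/3)) q.2) := by
      have h0 : ∀ᵐ q : ℝ × ℝ ∂(volume : Measure (ℝ × ℝ)), q.2 ≠ 0 := by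
        have h0' : ∀ᵐ u : ℝ ∂(volume : Measure ℝ), u ≠ 0 := by simp [ae_iff]
        rw [Measure.volume_eq_prod]
        exact Measure.quasiMeasurePreserving_snd.ae h0'
      filter_upwards [h0] with q hq
      by_cases hm : q ∈ sqBox
      · rw [indicator_of_mem hm, one_mul, indicator_of_mem hm.1, indicator_of_mem hm.2, hpair q hq]
        exact gaussSqS_le_sing h1 hα hβ q.1 q.2 hq
      · rw [indicator_of_notMem hm, zero_mul]; exact bot_le
    calc ∫⁻ q : ℝ × ℝ, sqBox.indicator (fun _ => (1 : ℝ≥0∞)) q * ∫⁻ v : (ℝ × ℝ) × (ℝ × ℝ), gS α β q v.1 * gS α β q v.2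
        ≤ ∫⁻ q : ℝ × ℝ, ENNReal.ofReal (hubK α β) *
            ({u : ℝ | u ^ 2 < 1}.indicator (singPow (1/3)) q.1 * {u : ℝ | u ^ 2 < 1}.indicator (singPow (1/3)) q.2) := lintegral_mono_ae hae
      _ = ENNReal.ofReal (hubK α β) * (Ising (1/3) * Ising (1/3)) := by
          have hm' : Measurable fun q : ℝ × ℝ =>
              {u : ℝ | u ^ 2 < 1}.indicator (singPow (1/3)) q.1 * {u : ℝ | u ^ 2 < 1}.indicator (singPow (1/3)) q.2 :=
            ((measurable_boxSing _).comp measurable_fst).mul ((measurable_boxSing _).comp measurable_snd)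
          rw [lintegral_const_mul _ hm', lintegral_volume_prod_mul (measurable_boxSing _) (measurable_boxSing _)]
          rfl
  rw [lintegral_volume_prod _ (measurable_FdomS α β)]
  have hout : ∀ p₀ : ℝ × ℝ, ∫⁻ u, FdomS α β (p₀, u) = sqBox.indicator (fun _ => (1 : ℝ≥0∞)) p₀ *
      ∫⁻ u : (ℝ × ℝ) × ((ℝ × ℝ) × (ℝ × ℝ)), sqBox.indicator (fun _ => (1 : ℝ≥0∞)) u.1 * (gS α β u.1 u.2.1 * gS α β u.1 u.2.2) := by
    intro p₀
    show ∫⁻ u : (ℝ × ℝ) × ((ℝ × ℝ) × (ℝ × ℝ)), sqBox.indicator (fun _ => (1 : ℝ≥0∞)) p₀ *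
        (sqBox.indicator (fun _ => (1 : ℝ≥0∞)) u.1 * (gS α β u.1 u.2.1 * gS α β u.1 u.2.2)) = _
    rw [lintegral_const_mul _ (measurable_FdomS_inner α β)]
  simp_rw [hout]
  rw [lintegral_mul_const _ (measurable_const.indicator measurableSet_sqBox), lintegral_indicator measurableSet_sqBox,
    setLIntegral_const, one_mul, volume_sqBox]
  exact mul_le_mul' le_rfl hmid

/-! ## §19 The integral of the dominator over the three letters -/

/-- The `(x, y)`-part of the dominator. [folklore] -/
def sigmaDomXY (A : ℍ) (z : ℍ × ℍ) : ℝ≥0∞ :=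
  axBox.indicator (fun _ => (1 : ℝ≥0∞)) z.1 * axBox.indicator (fun _ => (1 : ℝ≥0∞)) z.2 * ENNReal.ofReal (Real.exp (-(qLoad A z.1 z.2)))

/-- `sigmaDom A ((x,y),z) = sigmaDomXY A (x,y) · 𝟙_zBox(z) · e⁴`. [folklore] -/
theorem sigmaDom_eq (A : ℍ) (w : (ℍ × ℍ) × ℍ) :
    sigmaDom A w = sigmaDomXY A w.1 * (zBox.indicator (fun _ => (1 : ℝ≥0∞)) w.2 * ENNReal.ofReal (Real.exp 4)) := by
  rw [sigmaDom_def, sigmaDomXY, sub_eq_add_neg, Real.exp_add, ENNReal.ofReal_mul (Real.exp_pos _).le]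
  ring

/-- `axBox` is measurable. [folklore] -/
theorem measurableSet_axBox : MeasurableSet axBox := by
  have h1 : MeasurableSet {x : ℍ | x.re ^ 2 < 1} := measurableSet_lt (measurable_quat_re.pow_const 2) measurable_const
  have h2 : MeasurableSet {x : ℍ | x.imI ^ 2 < 1} := measurableSet_lt (measurable_quat_imI.pow_const 2) measurable_const
  have e : axBox = {x : ℍ | x.re ^ 2 < 1} ∩ {x : ℍ | x.imI ^ 2 < 1} := by ext x; simp [axBox]
  rw [e]; exact h1.inter h2

/-- `zBox` is measurable. [folklore] -/
theorem measurableSet_zBox : MeasurableSet zBox := by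
  have h1 : MeasurableSet {x : ℍ | x.re ^ 2 < 1} := measurableSet_lt (measurable_quat_re.pow_const 2) measurable_const
  have h2 : MeasurableSet {x : ℍ | x.imI ^ 2 < 1} := measurableSet_lt (measurable_quat_imI.pow_const 2) measurable_const
  have h3 : MeasurableSet {x : ℍ | x.imJ ^ 2 < 1} := measurableSet_lt (measurable_quat_imJ.pow_const 2) measurable_const
  have h4 : MeasurableSet {x : ℍ | x.imK ^ 2 < 1} := measurableSet_lt (measurable_quat_imK.pow_const 2) measurable_const
  have e : zBox = {x : ℍ | x.re ^ 2 < 1} ∩ ({x : ℍ | x.imI ^ 2 < 1} ∩ ({x : ℍ | x.imJ ^ 2 < 1} ∩ {x : ℍ | x.imK ^ 2 < 1})) := by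
    ext x; simp [zBox]
  rw [e]; exact h1.inter (h2.inter (h3.inter h4))

/-- `qLoad A` is measurable on `ℍ × ℍ`. [folklore] -/
theorem measurable_qLoad (A : ℍ) : Measurable fun z : ℍ × ℍ => qLoad A z.1 z.2 := by
  have e : (fun z : ℍ × ℍ => qLoad A z.1 z.2) = fun z => 4 * ((z.1.imK * z.2.imI - z.1.imI * z.2.imK) ^ 2 + (z.1.imI * z.2.imJ - z.1.imJ * z.2.imI) ^ 2) +
      4 * (A.imI ^ 2 * (z.2.imJ ^ 2 + z.2.imK ^ 2)) + A.re ^ 2 * A.imI ^ 2 * (z.1.imJ ^ 2 + z.1.imK ^ 2) +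
      16 / 9 * (A.imI ^ 2 * z.1.imI ^ 2 * (z.1.imJ ^ 2 + z.1.imK ^ 2)) := by
    funext z; rw [qLoad_def]
  rw [e]; fun_prop

/-- `sigmaDomXY A` is measurable. [folklore] -/
theorem measurable_sigmaDomXY (A : ℍ) : Measurable (sigmaDomXY A) := by
  unfold sigmaDomXY
  exact (((measurable_const.indicator measurableSet_axBox).comp measurable_fst).mul
    ((measurable_const.indicator measurableSet_axBox).comp measurable_snd)).mul
    (ENNReal.measurable_ofReal.comp (Real.measurable_exp.comp (measurable_qLoad A).neg))

/-- `sigmaDom A` is measurable on `(ℍ × ℍ) × ℍ`. [folklore] -/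
theorem measurable_sigmaDom (A : ℍ) : Measurable (sigmaDom A) := by
  have e : sigmaDom A = fun w => sigmaDomXY A w.1 * (zBox.indicator (fun _ => (1 : ℝ≥0∞)) w.2 * ENNReal.ofReal (Real.exp 4)) := by
    funext w; exact sigmaDom_eq A w
  rw [e]
  exact ((measurable_sigmaDomXY A).comp measurable_fst).mul
    (((measurable_const.indicator measurableSet_zBox).comp measurable_snd).mul measurable_const)

/-- The `(x, y)`-part is majorised by `FdomS` in the pair frame (an equality up to unfolding), for an axial hub. [folklore] -/
theorem sigmaDomXY_le_FdomS (A : ℍ) (z : ℍ × ℍ) : sigmaDomXY A z ≤ FdomS A.re A.imI (pairCoord z) := by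
  rw [sigmaDomXY]
  by_cases hx : z.1 ∈ axBox
  swap
  · rw [indicator_of_notMem hx, zero_mul, zero_mul]; exact bot_le
  by_cases hy : z.2 ∈ axBox
  swap
  · rw [indicator_of_notMem hy, mul_zero, zero_mul]; exact bot_le
  have h0 : (z.1.re, z.2.re) ∈ sqBox := ⟨hx.1, hy.1⟩
  have hI : (z.1.imI, z.2.imI) ∈ sqBox := ⟨hx.2, hy.2⟩
  refine le_of_eq ?_
  rw [indicator_of_mem hx, indicator_of_mem hy, one_mul, one_mul]
  unfold FdomS
  rw [show (pairCoord z).1 = (z.1.re, z.2.re) from rfl, show (pairCoord z).2.1 = (z.1.imI, z.2.imI) from rfl,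
    show (pairCoord z).2.2.1 = (z.1.imJ, z.2.imJ) from rfl, show (pairCoord z).2.2.2 = (z.1.imK, z.2.imK) from rfl,
    indicator_of_mem h0, indicator_of_mem hI, one_mul, one_mul]
  rw [gS_def, gS_def, ← ENNReal.ofReal_mul (Real.exp_pos _).le, ← Real.exp_add, qLoad_def]
  congr 2
  ring

/-- ★ `∫∫ sigmaDomXY A ≤ 4·K(α,β)·I(1/3)²` for an axial unit hub `A = (α, β, 0, 0)` with `αβ ≠ 0`. [folklore] -/
theorem lintegral_sigmaDomXY_le {A : ℍ} (h1 : A.re ^ 2 + A.imI ^ 2 = 1) (hα : A.re ≠ 0) (hβ : A.imI ≠ 0) :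
    ∫⁻ z, sigmaDomXY A z ∂((volume : Measure ℍ).prod volume) ≤ 4 * (ENNReal.ofReal (hubK A.re A.imI) * (Ising (1/3) * Ising (1/3))) := by
  calc ∫⁻ z, sigmaDomXY A z ∂((volume : Measure ℍ).prod volume)
      ≤ ∫⁻ z, FdomS A.re A.imI (pairCoord z) ∂((volume : Measure ℍ).prod volume) := lintegral_mono (sigmaDomXY_le_FdomS A)
    _ = ∫⁻ w, FdomS A.re A.imI w := measurePreserving_pairCoord.lintegral_comp (measurable_FdomS _ _)
    _ ≤ _ := lintegral_FdomS_le h1 hα hβ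

/-- The slaved-letter box has volume `16`. [folklore] -/
theorem volume_zBox : (volume : Measure ℍ) zBox = 16 := by
  set B : Set (ℝ × (ℝ × (ℝ × ℝ))) := {u : ℝ | u ^ 2 < 1} ×ˢ ({u : ℝ | u ^ 2 < 1} ×ˢ ({u : ℝ | u ^ 2 < 1} ×ˢ {u : ℝ | u ^ 2 < 1})) with hB
  have hBm : MeasurableSet B := measurableSet_sqLine.prod (measurableSet_sqLine.prod (measurableSet_sqLine.prod measurableSet_sqLine))
  have hpre : zBox = coord4 ⁻¹' B := by
    ext z; simp only [zBox, hB, Set.mem_setOf_eq, Set.mem_preimage, Set.mem_prod, coord4]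
  rw [hpre, measurePreserving_coord4.measure_preimage hBm.nullMeasurableSet, hB, Measure.volume_eq_prod, Measure.prod_prod,
    Measure.volume_eq_prod, Measure.prod_prod, Measure.volume_eq_prod, Measure.prod_prod, volume_sqBox_one]
  norm_num

/-- ★★ **THE DOMINATOR IS INTEGRABLE OVER THE THREE LETTERS**: for an axial unit hub `A = (α, β, 0, 0)` with `αβ ≠ 0`,
`∫_{vol³} sigmaDom A ≤ (4·K(α,β)·I(1/3)²)·(16·e⁴)`. [folklore] -/
theorem lintegral_sigmaDom_le {A : ℍ} (h1 : A.re ^ 2 + A.imI ^ 2 = 1) (hα : A.re ≠ 0) (hβ : A.imI ≠ 0) :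
    ∫⁻ w, sigmaDom A w ∂(((volume : Measure ℍ).prod volume).prod volume) ≤
      4 * (ENNReal.ofReal (hubK A.re A.imI) * (Ising (1/3) * Ising (1/3))) * (16 * ENNReal.ofReal (Real.exp 4)) := by
  have e : (fun w : (ℍ × ℍ) × ℍ => sigmaDom A w) = fun w => sigmaDomXY A w.1 * (zBox.indicator (fun _ => (1 : ℝ≥0∞)) w.2 * ENNReal.ofReal (Real.exp 4)) := by
    funext w; exact sigmaDom_eq A w
  have hz : Measurable fun z : ℍ => zBox.indicator (fun _ => (1 : ℝ≥0∞)) z * ENNReal.ofReal (Real.exp 4) :=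
    (measurable_const.indicator measurableSet_zBox).mul measurable_const
  rw [e, lintegral_prod_mul (measurable_sigmaDomXY A).aemeasurable hz.aemeasurable, lintegral_mul_const _ (measurable_const.indicator measurableSet_zBox),
    lintegral_indicator measurableSet_zBox, setLIntegral_const, one_mul, volume_zBox]
  exact mul_le_mul' (lintegral_sigmaDomXY_le h1 hα hβ) le_rfl

end Summit.QuantumFields.YangMills.Theorems.SwapVirialDeficit.ZeroModeSigma

end
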